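import Literature.RingTheory.KTheory.MilnorKWittGrothendieckRing
import Literature.RingTheory.KTheory.MilnorKTameSymbol
import Mathlib.Algebra.MonoidAlgebra.Lift
import Mathlib.Data.ZMod.Basic
import HarnessLib

/-!
# The additive presentation of `W(F)`, functoriality, and the residue homomorphisms `ψ, ∂ : W(K) → W(K̄)` of a
# discrete valuation (`∂(u) = 0`, `∂(πu) = (ū)`; `ρ = ψ + ∂` a ring homomorphism; `∂(IⁿK) ⊂ Iⁿ⁻¹K̄`) — Milnor,
# *Algebraic K-theory and quadratic forms*, Invent. Math. 9 (1970), §5 (Springer's theorem and Corollaries 5.1–5.2, the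
# maps `∂_π` and `ρ` of Theorem 5.3 / Lemma 5.4, the presentation of Lemma 5.6)

Family `hodge`, lane `lit-hodgefound` (foundations library; seat `lit-hodgefound-p27`, generation 41, row g41-#6);
topic `RingTheory/KTheory`.  Sequel of `MilnorKWittGrothendieckRing` (g41-#1: `Ŵ(F)`, `liftAdd`, `toWitt`, `ofWitt`,
`ker toWitt = (h)`), g40's `MilnorKWittRing` (the presented `WittRing F`, `gen`, `rels`, `fundIdeal`) and
`MilnorKTameSymbol` / `TameSymbol` (g40/g30: Milnor's integer valuation `addVal v`, the residue class field
`ValResidueField v`, the unit part `res v hπ : K• → K̄•`, and the four cases `MilnorK.rel_cases` of `x + y = 1`).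
DEFINITIONS WITH BODIES and PROVED THEOREMS; no named fact, no instance, no notation, 0 `sorry`, net debt 0 (D-0026).

## The source, verbatim

J. Milnor, *Algebraic K-theory and quadratic forms*, Invent. Math. 9 (1970) 318–344 (held `paper:doi-10-1007-bf01425486`;
bib key `Milnor1970`), §5 (p0016 L43 – p0017 L25): «First consider a field E which is complete under a discrete valuation
v, with residue class field Ē of characteristic ≠ 2. Let π be a prime element. THEOREM OF SPRINGER. The Witt ring WE
contains a subring W₀ canonically isomorphic to WĒ. Furthermore WE splits additively as the direct sum of W₀ and (π)W₀.
In fact W₀ can be defined as the subring generated by (u) as u ranges over units of E, and the isomorphism W₀ → WĒ is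
defined by the correspondence (u) ↦ (ū). For the proof, see T.A. Springer [16]. Since (π)² = (1), it follows that the
ring WE is completely determined by WĒ. COROLLARY 5.1. There is a split exact sequence 0 → WĒ → WE →∂ WĒ → 0, where
the first homomorphism carries (ū) to (u), and where ∂ is defined by the conditions ∂(u) = 0, ∂(πu) = (ū). Note
however that ∂ depends on the particular choice of the prime element π.»  Proof of Corollary 5.2 (p0017 L28–L38):
«the ideal IE then splits as a direct sum IE = IĒ ⊕ ((π) − (1))WĒ. It follows inductively that IⁿE = IⁿĒ ⊕ ((π) −
(1)) Iⁿ⁻¹Ē. Hence the sequence 5.1 gives rise to a split exact sequence (7ₙ) 0 → IⁿĒ → IⁿE →∂ Iⁿ⁻¹Ē → 0.»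
(p0018 L9–L11): «Let ∂_π : WE → WĒ_π denote the composition of the natural map WE → WE_π with the homomorphism ∂ of
5.1. Evidently ∂_π(u) = 0 and ∂_π(πu) = (ū).»  (p0018 L25–L26): «Note that L₀ is just the image of the natural
homomorphism WF → WE.»  Lemma 5.4 (p0018 L31–L39): «define ρ by the conditions ρ(u) = (ū), ρ(πu) = (ū). Here u
denotes any unit with respect to the (π)-adic valuation. It follows from Springer's theorem, applied to the (π)-adic
completion, that ρ is a well defined ring homomorphism.»  (p0019 L16–L21): «the identity (8) (a + b) = (a) + (b) −
(ab(a + b)) holds in the Witt ring of any field.»  Proof of Lemma 5.6 (p0020 L11–L18): «For any field F of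
characteristic ≠ 2 it is not difficult to show that the additive group of WF has a presentation in terms of generators
(a), where a ranges over F•, subject only to the relations (ab²) = (a), (a + b) = (a) + (b) − (ab(a + b)), (1) +
(−1) = 0, and their consequences.»

## What is formalised

* **The additive presentation of `W(F)`** (`char F ≠ 2`): the identity (8) `gen_add_gen'`; `W(F)` is additively
  generated by the `(a)` (`closure_range_gen`, `addMonoidHom_ext`); **`WittRing.liftAdd`** — every `g : F• → A` into an
  abelian group with `g(ab²) = g(a)`, `g(a) + g(−a) = 0`, `g(a) + g(b) = g(c) + g(abc)` (`c = λ²a + μ²b`) extends to an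
  additive homomorphism `W(F) → A`, `(a) ↦ g(a)` (`liftAdd_gen`, `liftAdd_unique`) — through `W = Ŵ/ℤh` of g41-#1.
* **Functoriality**: `WittRing.map σ : W(F) →+* W(E)`, `(a) ↦ (σa)`, for a field homomorphism `σ` («the natural
  homomorphism WF → WE»), `map_gen`, `fundIdeal_map_le`.
* **The residue homomorphisms of a discrete valuation** `v` on a field `K` with a prime element `π` (`addVal v π = 1`)
  and residue class field `K̄ = ValResidueField v`, built on the PRESENTED Witt ring with no completeness and no
  characteristic hypothesis, through the ring that Springer's theorem exhibits («WE = W₀ ⊕ (π)W₀», «(π)² = (1)»): the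
  group ring `springerRing v = W(K̄)[ℤ/2]` and the RING homomorphism **`springer v hπ : W(K) →+* W(K̄)[ℤ/2]`,
  `(uπⁱ) ↦ (ū)·tⁱ`** (`springer_gen`; well defined by the four cases of `x + y = 1`, `springerFun_rel`, and the
  scaling `springerFun_add`).  Its coordinates are **the first residue `fstResidue = ψ`, `ψ(u) = (ū)`, `ψ(πu) = 0`**,
  and **the second residue homomorphism `sndResidue = ∂ : W(K) →+ W(K̄)`, `∂(u) = 0`, `∂(πu) = (ū)`**
  (`sndResidue_gen_of_addVal_eq_zero`, `sndResidue_gen_pi_mul`; onto: `sndResidue_surjective`), and its augmentation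
  is **Lemma 5.4's ring homomorphism `rho : W(K) →+* W(K̄)`, `ρ(u) = (ū)`, `ρ(πu) = (ū)`** (`rho_gen`,
  `rho_eq_fstResidue_add_sndResidue`).
* **`∂(IⁿK) ⊂ Iⁿ⁻¹K̄`** (the map of (7ₙ) in the proof of Corollary 5.2; here for every discretely valued field):
  `sndResidue_mem_pow`, with `fstResidue_mem_pow`, `rho_mem_pow`.
* Not here: Springer's theorem proper (the section `WĒ → WE`, `(ū) ↦ (u)`, and `W₀ ≅ WĒ` need completeness),
  Theorem 5.3 (the exact sequence for `W(F(t))`), Lemmas 5.5–5.6.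

## References

* [Milnor1970] J. Milnor, *Algebraic K-theory and quadratic forms*, Invent. Math. 9 (1970) 318–344 — §4 «W = Ŵ/H»
  (p0014 L17–L22); §5: Springer's theorem and Corollary 5.1 (p0017 L5–L25), proof of Corollary 5.2 (p0017 L28–L38),
  `∂_π` (p0018 L9–L11), the natural map `WF → WE` (p0018 L25–L26), Lemma 5.4 and `ρ` (p0018 L27–L44), identity (8)
  (p0019 L16–L21), the additive presentation of `WF` (p0020 L11–L18).
* [Morel2012] F. Morel, *𝔸¹-Algebraic Topology over a Field*, LNM 2052 (2012) — Ch. 3 Lemma 3.9 and after: «W(F) […]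
  the quotient (both as a group or as a ring) GW(F)/(h)» (the road to `liftAdd`).
* [Knebusch2010] M. Knebusch, *Specialization of Quadratic and Symmetric Bilinear Forms*, Springer (2010) — Ch. 1
  Thm. 1.11 (PDF p. 16), the presentation of `W(K)` used by `MilnorKWittRing`.

Provenance: lane `lit-hodgefound`, seat `lit-hodgefound-p27` gen 41 (agent `literature-prover-lit-hodgefound-p27-g41-0`),
row g41-#6.
-/

set_option autoImplicit false

noncomputable section

namespace Literature.RingTheory.KTheory

open Function

namespace WittRing

/-! ### The additive presentation of `W(F)` -/

section Additive

variable (F : Type*) [Field F]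

/-- **Identity (8): `(a) + (b) = (a + b) + ((a + b)ab)`** in `W(F)` whenever `a + b ≠ 0` (Milnor's «(a + b) = (a) +
(b) − (ab(a + b))», «holds in the Witt ring of any field»). [cite: Milnor1970, §5 identity (8) (p0019 L16–L21); proof of Lemma 5.6 (p0020 L14–L16)] -/
theorem gen_add_gen' (a b c : Fˣ) (h : (c : F) = a + b) : gen F a + gen F b = gen F c + gen F (c * a * b) := by
  have h1 : (c : F) = ((1 : Fˣ) : F) ^ 2 * a + ((1 : Fˣ) : F) ^ 2 * b := by rw [Units.val_one, one_pow, one_mul, one_mul, h]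
  rw [gen_add_gen F h1, mul_comm (a * b) c, ← mul_assoc]

/-- **`W(F)` is additively generated by the `(a)`, `a ∈ F•`** («the additive group of WF has a presentation in terms of
generators (a)»). [cite: Milnor1970, §5 proof of Lemma 5.6 (p0020 L11–L13); Knebusch2010, Ch. 1 «W(K) is additively generated by the subset Q(K)» (PDF p. 16)] -/
theorem closure_range_gen : AddSubgroup.closure (Set.range (gen F)) = ⊤ := by
  rw [eq_top_iff]
  rintro w -
  obtain ⟨x, rfl⟩ := WittGrothendieckRing.toWitt_surjective F w
  have hx : x ∈ AddSubgroup.closure (Set.range (WittGrothendieckRing.gen F)) := by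
    rw [WittGrothendieckRing.closure_range_gen]; trivial
  induction hx using AddSubgroup.closure_induction with
  | mem y hy =>
    obtain ⟨a, rfl⟩ := hy
    rw [WittGrothendieckRing.toWitt_gen]
    exact AddSubgroup.subset_closure ⟨a, rfl⟩
  | zero => rw [map_zero]; exact zero_mem _
  | add y z _ _ hy hz => rw [map_add]; exact add_mem hy hz
  | neg y _ hy => rw [map_neg]; exact neg_mem hy

/-- Additive homomorphisms out of `W(F)` are determined by their values on the generators `(a)`. [cite: Milnor1970, §5 proof of Lemma 5.6 (p0020 L11–L18)] -/
theorem addMonoidHom_ext {A : Type*} [AddCommGroup A] {f f' : WittRing F →+ A}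
    (h : ∀ a : Fˣ, f (gen F a) = f' (gen F a)) : f = f' :=
  AddMonoidHom.eq_of_eqOn_dense (closure_range_gen F) (by rintro _ ⟨a, rfl⟩; exact h a)

variable {F}
variable {A : Type*} [AddCommGroup A]

/-- The additive lift to `Ŵ(F)` of a datum satisfying the three relations of `W(F)` kills the ideal `(h) = ℤh`,
`h = (1) + (−1)` (`char F ≠ 2`). [cite: Milnor1970, §4 «W = Ŵ/H, […] H is the free cyclic additive group spanned by (1) ⊕ (−1)» (p0014 L17–L20); §5 proof of Lemma 5.6 (p0020 L11–L18)] -/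
theorem liftAdd_hat_eq_zero_of_mem (h2 : (2 : F) ≠ 0) (g : Fˣ → A) (hsq : ∀ a b : Fˣ, g (a * b ^ 2) = g a)
    (hneg : ∀ a : Fˣ, g a + g (-a) = 0)
    (hadd : ∀ a b l m c : Fˣ, (c : F) = (l : F) ^ 2 * a + (m : F) ^ 2 * b → g a + g b = g c + g (a * b * c))
    {x : WittGrothendieckRing F} (hx : x ∈ Ideal.span {WittGrothendieckRing.hyp F}) :
    WittGrothendieckRing.liftAdd F g hsq hadd x = 0 := by
  obtain ⟨n, rfl⟩ := (WittGrothendieckRing.mem_span_hyp_iff F h2 x).1 hx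
  rw [← zsmul_eq_mul, map_zsmul, WittGrothendieckRing.hyp_def, map_add, WittGrothendieckRing.liftAdd_one,
    WittGrothendieckRing.liftAdd_gen, hneg, smul_zero]

/-- The descent of the additive lift to `Ŵ(F)/(h)`. [cite: Milnor1970, §4 «W = Ŵ/H» (p0014 L17–L20); §5 proof of Lemma 5.6 (p0020 L11–L18)] -/
def liftAddQuot (h2 : (2 : F) ≠ 0) (g : Fˣ → A) (hsq : ∀ a b : Fˣ, g (a * b ^ 2) = g a)
    (hneg : ∀ a : Fˣ, g a + g (-a) = 0)
    (hadd : ∀ a b l m c : Fˣ, (c : F) = (l : F) ^ 2 * a + (m : F) ^ 2 * b → g a + g b = g c + g (a * b * c)) :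
    WittGrothendieckRing F ⧸ Ideal.span {WittGrothendieckRing.hyp F} →+ A :=
  QuotientAddGroup.lift (Ideal.span {WittGrothendieckRing.hyp F}).toAddSubgroup
    (WittGrothendieckRing.liftAdd F g hsq hadd) fun _ hx =>
      (AddMonoidHom.mem_ker).2 (liftAdd_hat_eq_zero_of_mem h2 g hsq hneg hadd hx)

/-- `liftAddQuot` on classes. [cite: Milnor1970, §5 proof of Lemma 5.6 (p0020 L11–L18)] -/
theorem liftAddQuot_mk (h2 : (2 : F) ≠ 0) (g : Fˣ → A) (hsq : ∀ a b : Fˣ, g (a * b ^ 2) = g a)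
    (hneg : ∀ a : Fˣ, g a + g (-a) = 0)
    (hadd : ∀ a b l m c : Fˣ, (c : F) = (l : F) ^ 2 * a + (m : F) ^ 2 * b → g a + g b = g c + g (a * b * c))
    (x : WittGrothendieckRing F) :
    liftAddQuot h2 g hsq hneg hadd (Ideal.Quotient.mk (Ideal.span {WittGrothendieckRing.hyp F}) x) =
      WittGrothendieckRing.liftAdd F g hsq hadd x :=
  QuotientAddGroup.lift_mk _ _ x

variable (F) in
/-- **The additive presentation of `W(F)` (`char F ≠ 2`)**: «the additive group of WF has a presentation in terms of
generators (a), where a ranges over F•, subject only to the relations (ab²) = (a), (a + b) = (a) + (b) − (ab(a + b)),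
(1) + (−1) = 0» — every `g : F• → A` with `g(ab²) = g(a)`, `g(a) + g(−a) = 0` and `g(a) + g(b) = g(c) + g(abc)`
for `c = λ²a + μ²b` extends to an additive homomorphism `W(F) → A` (through `W = Ŵ/ℤh` and the additive presentation
of `Ŵ(F)`). [cite: Milnor1970, §5 proof of Lemma 5.6 (p0020 L11–L18); §4 «W = Ŵ/H» (p0014 L17–L20); Morel2012, Ch. 3 after Lemma 3.9 «W(F) […] the quotient (both as a group or as a ring) GW(F)/(h)»] -/
def liftAdd (h2 : (2 : F) ≠ 0) (g : Fˣ → A) (hsq : ∀ a b : Fˣ, g (a * b ^ 2) = g a)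
    (hneg : ∀ a : Fˣ, g a + g (-a) = 0)
    (hadd : ∀ a b l m c : Fˣ, (c : F) = (l : F) ^ 2 * a + (m : F) ^ 2 * b → g a + g b = g c + g (a * b * c)) :
    WittRing F →+ A :=
  (liftAddQuot h2 g hsq hneg hadd).comp (WittGrothendieckRing.ofWitt F h2).toAddMonoidHom

/-- **`liftAdd g (a) = g(a)`.** [cite: Milnor1970, §5 proof of Lemma 5.6 (p0020 L11–L18)] -/
theorem liftAdd_gen (h2 : (2 : F) ≠ 0) (g : Fˣ → A) (hsq : ∀ a b : Fˣ, g (a * b ^ 2) = g a)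
    (hneg : ∀ a : Fˣ, g a + g (-a) = 0)
    (hadd : ∀ a b l m c : Fˣ, (c : F) = (l : F) ^ 2 * a + (m : F) ^ 2 * b → g a + g b = g c + g (a * b * c))
    (a : Fˣ) : liftAdd F h2 g hsq hneg hadd (gen F a) = g a := by
  change liftAddQuot h2 g hsq hneg hadd (WittGrothendieckRing.ofWitt F h2 (gen F a)) = g a
  rw [← WittGrothendieckRing.toWitt_gen, WittGrothendieckRing.ofWitt_toWitt, liftAddQuot_mk,
    WittGrothendieckRing.liftAdd_gen]

/-- `liftAdd g 1 = g(1)`. [cite: Milnor1970, §5 proof of Lemma 5.6 (p0020 L11–L18)] -/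
theorem liftAdd_one (h2 : (2 : F) ≠ 0) (g : Fˣ → A) (hsq : ∀ a b : Fˣ, g (a * b ^ 2) = g a)
    (hneg : ∀ a : Fˣ, g a + g (-a) = 0)
    (hadd : ∀ a b l m c : Fˣ, (c : F) = (l : F) ^ 2 * a + (m : F) ^ 2 * b → g a + g b = g c + g (a * b * c)) :
    liftAdd F h2 g hsq hneg hadd 1 = g 1 := by
  rw [← gen_one, liftAdd_gen]

/-- Uniqueness of the additive extension. [cite: Milnor1970, §5 proof of Lemma 5.6 (p0020 L11–L18)] -/
theorem liftAdd_unique (h2 : (2 : F) ≠ 0) (g : Fˣ → A) (hsq : ∀ a b : Fˣ, g (a * b ^ 2) = g a)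
    (hneg : ∀ a : Fˣ, g a + g (-a) = 0)
    (hadd : ∀ a b l m c : Fˣ, (c : F) = (l : F) ^ 2 * a + (m : F) ^ 2 * b → g a + g b = g c + g (a * b * c))
    (f : WittRing F →+ A) (hf : ∀ a, f (gen F a) = g a) : f = liftAdd F h2 g hsq hneg hadd :=
  addMonoidHom_ext F fun a => by rw [hf, liftAdd_gen]

end Additive

/-! ### Functoriality `W(F) → W(E)` -/

section Map

variable {F E : Type*} [Field F] [Field E] (σ : F →+* E)

/-- The lift of `(a) ↦ (σa)` to the free commutative ring on `F•`. [cite: Milnor1970, §5 «the natural homomorphism WF → WE» (p0018 L25–L26)] -/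
def mapLift : FreeCommRing Fˣ →+* WittRing E := FreeCommRing.lift fun a => gen E (Units.map (σ : F →* E) a)

/-- `mapLift (a) = (σa)`. [cite: Milnor1970, §5 (p0018 L25–L26)] -/
theorem mapLift_og (a : Fˣ) : mapLift σ (og F a) = gen E (Units.map (σ : F →* E) a) := FreeCommRing.lift_of _ a

/-- The value of `σ` on a unit, as an element of `E`. [folklore] -/
private theorem coe_units_map (a : Fˣ) : ((Units.map (σ : F →* E) a : Eˣ) : E) = σ a := rfl

/-- `σ(−a) = −σ(a)` on units. [folklore] -/
private theorem units_map_neg (a : Fˣ) : Units.map (σ : F →* E) (-a) = -Units.map (σ : F →* E) a :=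
  Units.ext (by rw [Units.val_neg, coe_units_map, coe_units_map, Units.val_neg, map_neg])

/-- The defining relations of `W(F)` map to relations of `W(E)`. [cite: Milnor1970, §5 (p0018 L25–L26); Knebusch2010, Ch. 1 Thm. 1.11 (PDF p. 16)] -/
theorem mapLift_eq_zero_of_mem_rels {x : FreeCommRing Fˣ} (hx : x ∈ rels F) : mapLift σ x = 0 := by
  rcases hx with ⟨a, b, rfl⟩ | rfl | ⟨a, b, rfl⟩ | ⟨a, rfl⟩ | ⟨a, b, l, m, c, hc, rfl⟩
  · rw [map_sub, map_mul, mapLift_og, mapLift_og, mapLift_og, map_mul, gen_mul, sub_self]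
  · rw [map_sub, map_one, mapLift_og, map_one, gen_one, sub_self]
  · rw [map_sub, mapLift_og, mapLift_og, map_mul, map_pow, gen_mul_sq, sub_self]
  · rw [map_add, mapLift_og, mapLift_og, units_map_neg, gen_add_gen_neg]
  · rw [map_sub, map_sub, map_add, mapLift_og, mapLift_og, mapLift_og, mapLift_og, map_mul, map_mul]
    have hc' : ((Units.map (σ : F →* E) c : Eˣ) : E) =
        ((Units.map (σ : F →* E) l : Eˣ) : E) ^ 2 * (Units.map (σ : F →* E) a : Eˣ) +
          ((Units.map (σ : F →* E) m : Eˣ) : E) ^ 2 * (Units.map (σ : F →* E) b : Eˣ) := by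
      simp only [coe_units_map]
      rw [hc, map_add, map_mul, map_mul, map_pow, map_pow]
    rw [gen_add_gen E hc', sub_sub, sub_self]

/-- **The natural homomorphism `W(F) → W(E)`, `(a) ↦ (σa)`, of a field homomorphism `σ : F → E`.** [cite: Milnor1970, §5 «Note that L₀ is just the image of the natural homomorphism WF → WE» (p0018 L25–L26); Cor. 5.1 «the first homomorphism carries (ū) to (u)» (p0017 L16)] -/
def map : WittRing F →+* WittRing E :=
  Ideal.Quotient.lift (Ideal.span (rels F)) (mapLift σ) fun _ hx => by
    have h : Ideal.span (rels F) ≤ RingHom.ker (mapLift σ) :=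
      Ideal.span_le.2 fun y hy => (RingHom.mem_ker).2 (mapLift_eq_zero_of_mem_rels σ hy)
    exact (RingHom.mem_ker).1 (h hx)

/-- **`map σ (a) = (σa)`.** [cite: Milnor1970, §5 (p0018 L25–L26)] -/
theorem map_gen (a : Fˣ) : map σ (gen F a) = gen E (Units.map (σ : F →* E) a) := by
  rw [gen_def, map, Ideal.Quotient.lift_mk, mapLift_og]

/-- `map σ` carries the fundamental ideal `I(F)` into `I(E)`. [cite: Milnor1970, §5 (p0018 L25–L26); §4 «I = IF» (p0014 L20–L22)] -/
theorem fundIdeal_map_le : (fundIdeal F).map (map σ) ≤ fundIdeal E := by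
  rw [fundIdeal, Ideal.map_span, Ideal.span_le]
  rintro _ ⟨_, ⟨a, rfl⟩, rfl⟩
  rw [map_sub, map_one, map_gen]
  exact gen_sub_one_mem E _

/-- `map σ` carries `Iⁿ(F)` into `Iⁿ(E)`. [cite: Milnor1970, §5 (p0018 L25–L26); §4 (p0014 L20–L22)] -/
theorem map_mem_pow_fundIdeal {n : ℕ} {w : WittRing F} (hw : w ∈ fundIdeal F ^ n) : map σ w ∈ fundIdeal E ^ n := by
  have h := Ideal.mem_map_of_mem (map σ) hw
  rw [Ideal.map_pow] at h
  exact Ideal.pow_right_mono (fundIdeal_map_le σ) n h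

end Map

/-! ### The residue homomorphisms of a discrete valuation -/

section Residue

variable {K : Type*} [Field K] (v : Valuation K (WithZero (Multiplicative ℤ))) {π : Kˣ}

/-- Arithmetic of `ℤ/2`: `z + z = 0`. [folklore] -/
private theorem zmod_two_add_self : ∀ z : ZMod 2, z + z = 0 := by decide

/-- Arithmetic of `ℤ/2`: every element is `0` or `1`. [folklore] -/
private theorem zmod_two_eq_zero_or_eq_one : ∀ z : ZMod 2, z = 0 ∨ z = 1 := by decide

/-- Arithmetic of `ℤ/2`: `1 ≠ 0`. [folklore] -/
private theorem zmod_two_one_ne_zero : (1 : ZMod 2) ≠ 0 := by decide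

/-- **The parity `v(x) mod 2 ∈ ℤ/2`** of the valuation of `x ∈ K•` (the exponent of `(π)` in Springer's decomposition
`WE = W₀ ⊕ (π)W₀`, «(π)² = (1)»). [cite: Milnor1970, §5 Springer's theorem «WE splits additively as the direct sum of W₀ and (π)W₀», «Since (π)² = (1) […]» (p0017 L5–L10)] -/
def valParity (x : Kˣ) : ZMod 2 := ((addVal v x : ℤ) : ZMod 2)

/-- `valParity` unfolded. [cite: Milnor1970, §5 (p0017 L5–L10)] -/
theorem valParity_def (x : Kˣ) : valParity v x = ((addVal v x : ℤ) : ZMod 2) := rfl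

/-- `valParity (xy) = valParity x + valParity y`. [cite: Milnor1970, §5 (p0017 L5–L10)] -/
theorem valParity_mul (x y : Kˣ) : valParity v (x * y) = valParity v x + valParity v y := by
  rw [valParity_def, addVal_mul, Int.cast_add, valParity_def, valParity_def]

/-- `valParity 1 = 0`. [cite: Milnor1970, §5 (p0017 L5–L10)] -/
theorem valParity_one : valParity v 1 = 0 := by rw [valParity_def, addVal_one, Int.cast_zero]

/-- A unit has parity `0`. [cite: Milnor1970, §5 (p0017 L5–L10)] -/
theorem valParity_of_addVal_eq_zero {u : Kˣ} (hu : addVal v u = 0) : valParity v u = 0 := by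
  rw [valParity_def, hu, Int.cast_zero]

/-- A prime element has parity `1`. [cite: Milnor1970, §5 (p0017 L5–L10)] -/
theorem valParity_of_addVal_eq_one (hπ : addVal v π = 1) : valParity v π = 1 := by
  rw [valParity_def, hπ, Int.cast_one]

/-- `valParity (−x) = valParity x`. [cite: Milnor1970, §5 (p0017 L5–L10)] -/
theorem valParity_neg (x : Kˣ) : valParity v (-x) = valParity v x := by rw [valParity_def, addVal_neg, valParity_def]

/-- `valParity x + valParity x = 0` («(π)² = (1)»). [cite: Milnor1970, §5 (p0017 L9–L10)] -/
theorem valParity_add_self (x : Kˣ) : valParity v x + valParity v x = 0 := zmod_two_add_self _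

/-- `valParity (b²) = 0`. [cite: Milnor1970, §5 (p0017 L9–L10)] -/
theorem valParity_sq (b : Kˣ) : valParity v (b ^ 2) = 0 := by rw [pow_two, valParity_mul, valParity_add_self]

/-- `valParity x = 0 ↔ v(x)` even. [cite: Milnor1970, §5 (p0017 L5–L10)] -/
theorem valParity_eq_zero_iff (x : Kˣ) : valParity v x = 0 ↔ Even (addVal v x) := ZMod.intCast_eq_zero_iff_even

/-- `valParity x = 1 ↔ v(x)` odd. [cite: Milnor1970, §5 (p0017 L5–L10)] -/
theorem valParity_eq_one_iff (x : Kˣ) : valParity v x = 1 ↔ Odd (addVal v x) := ZMod.intCast_eq_one_iff_odd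

/-- `valParity x` is `0` or `1` (`v(x)` is even or odd). [cite: Milnor1970, §5 «WE splits additively as the direct sum of W₀ and (π)W₀» (p0017 L5–L10)] -/
theorem valParity_eq_zero_or_eq_one (x : Kˣ) : valParity v x = 0 ∨ valParity v x = 1 := zmod_two_eq_zero_or_eq_one _

variable (hπ : addVal v π = 1)

/-- **Springer's ring `W(K̄)[ℤ/2]`** — the group ring of `ℤ/2` over the Witt ring of the residue class field: the shape
of `WE = W₀ ⊕ (π)W₀`, `W₀ ≅ WĒ`, `(π)² = (1)` («the ring WE is completely determined by WĒ»). An element is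
`a + bt` (`a = coeff 0`, `b = coeff 1`, `t = single 1 1`, `t² = 1`). [cite: Milnor1970, §5 Springer's theorem (p0017 L5–L10)] -/
abbrev springerRing : Type _ := AddMonoidAlgebra (WittRing (ValResidueField v)) (ZMod 2)

/-- **`(uπⁱ) ↦ (ū)·tⁱ`** on generators: the class of the residue of the unit part, placed in degree `v(x) mod 2`.
[cite: Milnor1970, §5 Springer's theorem and Cor. 5.1 «(u) ↦ (ū)», «∂(u) = 0, ∂(πu) = (ū)» (p0017 L5–L22)] -/
def springerFun (x : Kˣ) : springerRing v :=
  AddMonoidAlgebra.single (valParity v x) (gen (ValResidueField v) (res v hπ x))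

/-- `springerFun` unfolded. [cite: Milnor1970, §5 (p0017 L5–L22)] -/
theorem springerFun_def (x : Kˣ) :
    springerFun v hπ x = AddMonoidAlgebra.single (valParity v x) (gen (ValResidueField v) (res v hπ x)) := rfl

/-- `springerFun` is multiplicative (`(x)(y) = (xy)`, `x̄ȳ = x̄·ȳ`, parities add). [cite: Milnor1970, §5 (p0017 L5–L10); §3 «(a)(b) = (ab)» (p0012 L19–L21)] -/
theorem springerFun_mul (x y : Kˣ) : springerFun v hπ (x * y) = springerFun v hπ x * springerFun v hπ y := by
  rw [springerFun_def, springerFun_def, springerFun_def, AddMonoidAlgebra.single_mul_single, ← gen_mul, ← map_mul,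
    valParity_mul]

/-- `springerFun 1 = 1`. [cite: Milnor1970, §5 (p0017 L5–L10)] -/
theorem springerFun_one : springerFun v hπ 1 = 1 := by
  rw [springerFun_def, valParity_one, map_one, gen_one, AddMonoidAlgebra.one_def]

/-- A unit `y ≡ 1 (mod 𝔭)` goes to `1`. [cite: Milnor1970, §5 Cor. 5.1 «∂(u) = 0» (p0017 L16–L22)] -/
theorem springerFun_of_res_eq_one {y : Kˣ} (hy : addVal v y = 0) (hres : res v hπ y = 1) : springerFun v hπ y = 1 := by
  rw [springerFun_def, valParity_of_addVal_eq_zero v hy, hres, gen_one, AddMonoidAlgebra.one_def]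

/-- The square-class relation `springerFun (ab²) = springerFun a`. [cite: Milnor1970, §5 proof of Lemma 5.6 «(ab²) = (a)» (p0020 L14)] -/
theorem springerFun_mul_sq (a b : Kˣ) : springerFun v hπ (a * b ^ 2) = springerFun v hπ a := by
  rw [springerFun_def, springerFun_def, valParity_mul, valParity_sq, add_zero, map_mul, map_pow, gen_mul_sq]

/-- The hyperbolic relation `springerFun a + springerFun (−a) = 0`. [cite: Milnor1970, §5 proof of Lemma 5.6 «(1) + (−1) = 0» (p0020 L17)] -/
theorem springerFun_add_neg (a : Kˣ) : springerFun v hπ a + springerFun v hπ (-a) = 0 := by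
  rw [springerFun_def, springerFun_def, valParity_neg, res_neg, ← AddMonoidAlgebra.single_add, gen_add_gen_neg,
    AddMonoidAlgebra.single_zero]

/-- **`springerFun` respects `x + y = 1`: `S(x) + S(y) = 1 + S(xy)`** — by the four cases of `MilnorK.rel_cases`
(`v(x) > 0`: `ȳ = 1`; `v(y) > 0`: `x̄ = 1`; both units: `x̄ + ȳ = 1` and identity (8) in `W(K̄)`; `v(x) = v(y) < 0`:
`ȳ = −x̄`, both sides vanish as `(π)² = (1)`). [cite: Milnor1970, §5 Cor. 5.1 «The proof is straightforward» (p0017 L11–L25); §2 proof of Lemma 2.1, the four cases (p0007 L14–L25); identity (8) (p0019 L16–L21)] -/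
theorem springerFun_rel {x y : Kˣ} (h : (x : K) + y = 1) :
    springerFun v hπ x + springerFun v hπ y = 1 + springerFun v hπ (x * y) := by
  rcases MilnorK.rel_cases v hπ h with ⟨hy, hres⟩ | ⟨hx, hres⟩ | ⟨hx, hy, hres⟩ | ⟨hxy, hres⟩
  · rw [springerFun_mul, springerFun_of_res_eq_one v hπ hy hres, mul_one, add_comm]
  · rw [springerFun_mul, springerFun_of_res_eq_one v hπ hx hres, one_mul]
  · have h1 : ((1 : (ValResidueField v)ˣ) : ValResidueField v) =
        ((1 : (ValResidueField v)ˣ) : ValResidueField v) ^ 2 * (res v hπ x : (ValResidueField v)ˣ) +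
          ((1 : (ValResidueField v)ˣ) : ValResidueField v) ^ 2 * (res v hπ y : (ValResidueField v)ˣ) := by
      rw [Units.val_one, one_pow, one_mul, one_mul, hres]
    rw [springerFun_def, springerFun_def, springerFun_def, valParity_of_addVal_eq_zero v hx,
      valParity_of_addVal_eq_zero v hy, valParity_mul, valParity_of_addVal_eq_zero v hx,
      valParity_of_addVal_eq_zero v hy, add_zero, ← AddMonoidAlgebra.single_add, gen_add_gen _ h1, gen_one, mul_one,
      map_mul, AddMonoidAlgebra.one_def, ← AddMonoidAlgebra.single_add]
  · have hp : valParity v y = valParity v x := by rw [valParity_def, valParity_def, hxy]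
    rw [springerFun_def, springerFun_def, springerFun_def, map_mul, hres, hp, ← AddMonoidAlgebra.single_add,
      gen_add_gen_neg, AddMonoidAlgebra.single_zero, valParity_mul, hp, valParity_add_self, mul_neg, ← pow_two,
      ← neg_one_mul, gen_mul_sq, gen_neg_one, AddMonoidAlgebra.one_def, ← AddMonoidAlgebra.single_add, add_neg_cancel,
      AddMonoidAlgebra.single_zero]

/-- An identity in the group `K•`. [folklore] -/
private theorem mul_mul_sq_mul_inv (a l c : Kˣ) : c * (a * l ^ 2 * c⁻¹) = a * l ^ 2 := by
  rw [mul_comm, inv_mul_cancel_right]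

/-- An identity in the group `K•`. [folklore] -/
private theorem mul_prod_eq (a b l m c : Kˣ) :
    c * (a * l ^ 2 * c⁻¹ * (b * m ^ 2 * c⁻¹)) = a * b * c * (l * m * c⁻¹) ^ 2 := by
  apply Units.ext
  push_cast
  field_simp

/-- **The scaled relation: `S(a) + S(b) = S(c) + S(abc)` for `c = λ²a + μ²b`** (from `springerFun_rel` for
`x = λ²a/c`, `y = μ²b/c`, multiplied by `S(c)`). [cite: Milnor1970, §5 Cor. 5.1 (p0017 L11–L25); Knebusch2010, Ch. 1 Thm. 1.11 (PDF p. 16)] -/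
theorem springerFun_add (a b l m c : Kˣ) (hc : (c : K) = (l : K) ^ 2 * a + (m : K) ^ 2 * b) :
    springerFun v hπ a + springerFun v hπ b = springerFun v hπ c + springerFun v hπ (a * b * c) := by
  have hxy : ((a * l ^ 2 * c⁻¹ : Kˣ) : K) + ((b * m ^ 2 * c⁻¹ : Kˣ) : K) = 1 := by
    have hc0 : (c : K) ≠ 0 := c.ne_zero
    have hc1 : (a : K) * (l : K) ^ 2 + (b : K) * (m : K) ^ 2 = c := by rw [hc]; ring
    push_cast
    rw [← add_mul, hc1, mul_inv_cancel₀ hc0]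
  have h := congrArg (fun t => springerFun v hπ c * t) (springerFun_rel v hπ hxy)
  simp only [mul_add, mul_one, ← springerFun_mul] at h
  rwa [mul_mul_sq_mul_inv, mul_mul_sq_mul_inv, mul_prod_eq, springerFun_mul_sq, springerFun_mul_sq,
    springerFun_mul_sq] at h

/-- The lift of `springerFun` to the free commutative ring on `K•`. [cite: Milnor1970, §5 (p0017 L5–L25)] -/
def springerLift : FreeCommRing Kˣ →+* springerRing v := FreeCommRing.lift (springerFun v hπ)

/-- `springerLift (a) = springerFun a`. [cite: Milnor1970, §5 (p0017 L5–L25)] -/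
theorem springerLift_og (a : Kˣ) : springerLift v hπ (og K a) = springerFun v hπ a := FreeCommRing.lift_of _ a

/-- `springerLift` kills the defining relations of `W(K)`. [cite: Milnor1970, §5 (p0017 L5–L25); Knebusch2010, Ch. 1 Thm. 1.11 (PDF p. 16)] -/
theorem springerLift_eq_zero_of_mem_rels {x : FreeCommRing Kˣ} (hx : x ∈ rels K) : springerLift v hπ x = 0 := by
  rcases hx with ⟨a, b, rfl⟩ | rfl | ⟨a, b, rfl⟩ | ⟨a, rfl⟩ | ⟨a, b, l, m, c, hc, rfl⟩
  · rw [map_sub, map_mul, springerLift_og, springerLift_og, springerLift_og, springerFun_mul, sub_self]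
  · rw [map_sub, map_one, springerLift_og, springerFun_one, sub_self]
  · rw [map_sub, springerLift_og, springerLift_og, springerFun_mul_sq, sub_self]
  · rw [map_add, springerLift_og, springerLift_og, springerFun_add_neg]
  · rw [map_sub, map_sub, map_add, springerLift_og, springerLift_og, springerLift_og, springerLift_og,
      springerFun_add v hπ a b l m c hc, sub_sub, sub_self]

/-- **The ring homomorphism `W(K) → W(K̄)[ℤ/2]`, `(uπⁱ) ↦ (ū)tⁱ`** (Springer: «WE = W₀ ⊕ (π)W₀», «(u) ↦ (ū)»,
«(π)² = (1)»; here out of the presented Witt ring of any discretely valued field, no completeness needed). [cite: Milnor1970, §5 Springer's theorem and Cor. 5.1 (p0017 L5–L25)] -/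
def springer : WittRing K →+* springerRing v :=
  Ideal.Quotient.lift (Ideal.span (rels K)) (springerLift v hπ) fun _ hx => by
    have h : Ideal.span (rels K) ≤ RingHom.ker (springerLift v hπ) :=
      Ideal.span_le.2 fun y hy => (RingHom.mem_ker).2 (springerLift_eq_zero_of_mem_rels v hπ hy)
    exact (RingHom.mem_ker).1 (h hx)

/-- **`springer (x) = (x̄′)·t^{v(x)}`** (`x̄′` the residue of the unit part of `x`). [cite: Milnor1970, §5 (p0017 L5–L25)] -/
theorem springer_gen (x : Kˣ) :
    springer v hπ (gen K x) = AddMonoidAlgebra.single (valParity v x) (gen (ValResidueField v) (res v hπ x)) := by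
  rw [gen_def, springer, Ideal.Quotient.lift_mk, springerLift_og, springerFun_def]

/-- `springer (u) = (ū)·1` for a unit `u`. [cite: Milnor1970, §5 «(u) ↦ (ū)» (p0017 L7–L8)] -/
theorem springer_gen_of_addVal_eq_zero {u : Kˣ} (hu : addVal v u = 0) :
    springer v hπ (gen K u) = AddMonoidAlgebra.single 0 (gen (ValResidueField v) (res v hπ u)) := by
  rw [springer_gen, valParity_of_addVal_eq_zero v hu]

/-- `springer (πu) = (ū)·t` for a unit `u`. [cite: Milnor1970, §5 Cor. 5.1 «∂(πu) = (ū)» (p0017 L16–L22)] -/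
theorem springer_gen_pi_mul {u : Kˣ} (hu : addVal v u = 0) :
    springer v hπ (gen K (π * u)) = AddMonoidAlgebra.single 1 (gen (ValResidueField v) (res v hπ u)) := by
  rw [springer_gen, valParity_mul, valParity_of_addVal_eq_one v hπ, valParity_of_addVal_eq_zero v hu, add_zero, map_mul,
    res_pi, one_mul]

/-- `springer (π) = t`. [cite: Milnor1970, §5 (p0017 L5–L22)] -/
theorem springer_gen_pi : springer v hπ (gen K π) = AddMonoidAlgebra.single 1 1 := by
  rw [springer_gen, valParity_of_addVal_eq_one v hπ, res_pi, gen_one]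

/-- **The coefficient functionals `a + bt ↦ a`, `a + bt ↦ b`** of `W(K̄)[ℤ/2]` (the projections of
`WE = W₀ ⊕ (π)W₀`). [cite: Milnor1970, §5 Springer's theorem (p0017 L5–L8)] -/
def coeffHom (i : ZMod 2) : springerRing v →+ WittRing (ValResidueField v) where
  toFun s := s.coeff i
  map_zero' := by simp
  map_add' s s' := by simp [AddMonoidAlgebra.coeff_add]

/-- `coeffHom i s = s.coeff i`. [cite: Milnor1970, §5 (p0017 L5–L8)] -/
theorem coeffHom_apply (i : ZMod 2) (s : springerRing v) : coeffHom v i s = s.coeff i := rfl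

/-- `coeffHom i (w·tⁱ) = w`. [cite: Milnor1970, §5 (p0017 L5–L8)] -/
theorem coeffHom_single_self (i : ZMod 2) (w : WittRing (ValResidueField v)) :
    coeffHom v i (AddMonoidAlgebra.single i w) = w := by
  rw [coeffHom_apply, AddMonoidAlgebra.coeff_single, Finsupp.single_eq_same]

/-- `coeffHom i (w·tʲ) = 0` for `j ≠ i`. [cite: Milnor1970, §5 (p0017 L5–L8)] -/
theorem coeffHom_single_of_ne {i j : ZMod 2} (h : i ≠ j) (w : WittRing (ValResidueField v)) :
    coeffHom v i (AddMonoidAlgebra.single j w) = 0 := by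
  rw [coeffHom_apply, AddMonoidAlgebra.coeff_single, Finsupp.single_eq_of_ne h]

/-- Every element of `W(K̄)[ℤ/2]` is `a + bt`. [cite: Milnor1970, §5 «WE splits additively as the direct sum of W₀ and (π)W₀» (p0017 L5–L6)] -/
theorem eq_single_add_single (s : springerRing v) :
    s = AddMonoidAlgebra.single 0 (s.coeff 0) + AddMonoidAlgebra.single 1 (s.coeff 1) := by
  apply AddMonoidAlgebra.ext
  ext i
  rcases zmod_two_eq_zero_or_eq_one i with rfl | rfl
  · simp [AddMonoidAlgebra.coeff_add, AddMonoidAlgebra.coeff_single]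
  · simp [AddMonoidAlgebra.coeff_add, AddMonoidAlgebra.coeff_single]

/-- **The first residue homomorphism `ψ : W(K) → W(K̄)`** (the projection onto Springer's `W₀ ≅ WĒ`): the
`t⁰`-coefficient of `springer`. [cite: Milnor1970, §5 Springer's theorem «the isomorphism W₀ → WĒ is defined by the correspondence (u) ↦ (ū)» (p0017 L5–L8)] -/
def fstResidue : WittRing K →+ WittRing (ValResidueField v) := (coeffHom v 0).comp (springer v hπ).toAddMonoidHom

/-- **The second residue homomorphism `∂ = ∂_π : W(K) → W(K̄)`**: the `t¹`-coefficient of `springer`. [cite: Milnor1970, §5 Cor. 5.1 «∂ is defined by the conditions ∂(u) = 0, ∂(πu) = (ū). Note however that ∂ depends on the particular choice of the prime element π» (p0017 L11–L25); «∂_π» (p0018 L9–L11)] -/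
def sndResidue : WittRing K →+ WittRing (ValResidueField v) := (coeffHom v 1).comp (springer v hπ).toAddMonoidHom

/-- `ψ w = (springer w).coeff 0`. [cite: Milnor1970, §5 (p0017 L5–L8)] -/
theorem fstResidue_apply (w : WittRing K) : fstResidue v hπ w = (springer v hπ w).coeff 0 := rfl

/-- `∂ w = (springer w).coeff 1`. [cite: Milnor1970, §5 Cor. 5.1 (p0017 L11–L25)] -/
theorem sndResidue_apply (w : WittRing K) : sndResidue v hπ w = (springer v hπ w).coeff 1 := rfl

/-- `∂(x) = 0` when `v(x)` is even. [cite: Milnor1970, §5 Cor. 5.1 «∂(u) = 0» (p0017 L16–L22)] -/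
theorem sndResidue_gen_of_even {x : Kˣ} (hx : Even (addVal v x)) : sndResidue v hπ (gen K x) = 0 := by
  rw [← valParity_eq_zero_iff v] at hx
  rw [sndResidue, AddMonoidHom.comp_apply, RingHom.toAddMonoidHom_eq_coe, AddMonoidHom.coe_coe, springer_gen, hx,
    coeffHom_single_of_ne v zmod_two_one_ne_zero]

/-- `∂(x) = (x̄′)` (residue of the unit part) when `v(x)` is odd. [cite: Milnor1970, §5 Cor. 5.1 «∂(πu) = (ū)» (p0017 L16–L22)] -/
theorem sndResidue_gen_of_odd {x : Kˣ} (hx : Odd (addVal v x)) :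
    sndResidue v hπ (gen K x) = gen (ValResidueField v) (res v hπ x) := by
  rw [← valParity_eq_one_iff v] at hx
  rw [sndResidue, AddMonoidHom.comp_apply, RingHom.toAddMonoidHom_eq_coe, AddMonoidHom.coe_coe, springer_gen, hx,
    coeffHom_single_self]

/-- **`∂(u) = 0`** for a unit `u`. [cite: Milnor1970, §5 Cor. 5.1 «∂(u) = 0» (p0017 L16–L22); «∂_π(u) = 0» (p0018 L11)] -/
theorem sndResidue_gen_of_addVal_eq_zero {u : Kˣ} (hu : addVal v u = 0) : sndResidue v hπ (gen K u) = 0 :=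
  sndResidue_gen_of_even v hπ (by rw [hu]; exact Even.zero)

/-- **`∂(πu) = (ū)`** for a unit `u`. [cite: Milnor1970, §5 Cor. 5.1 «∂(πu) = (ū)» (p0017 L16–L22); «∂_π(πu) = (ū)» (p0018 L11)] -/
theorem sndResidue_gen_pi_mul {u : Kˣ} (hu : addVal v u = 0) :
    sndResidue v hπ (gen K (π * u)) = gen (ValResidueField v) (res v hπ u) := by
  rw [sndResidue, AddMonoidHom.comp_apply, RingHom.toAddMonoidHom_eq_coe, AddMonoidHom.coe_coe,
    springer_gen_pi_mul v hπ hu, coeffHom_single_self]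

/-- `∂(πu) = (ū)` with `ū` the honest residue class of the unit `u`. [cite: Milnor1970, §5 Cor. 5.1 «∂(πu) = (ū)» (p0017 L16–L22)] -/
theorem sndResidue_gen_pi_mul' {u : Kˣ} (hu : addVal v u = 0) :
    sndResidue v hπ (gen K (π * u)) = gen (ValResidueField v) (residueUnitHom v (unitOfEqOne v u hu)) := by
  rw [sndResidue_gen_pi_mul v hπ hu, res_of_addVal_eq_zero v hπ hu]

/-- `∂(π) = (1) = 1`. [cite: Milnor1970, §5 Cor. 5.1 «∂(πu) = (ū)» (p0017 L16–L22)] -/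
theorem sndResidue_gen_pi : sndResidue v hπ (gen K π) = 1 := by
  rw [sndResidue, AddMonoidHom.comp_apply, RingHom.toAddMonoidHom_eq_coe, AddMonoidHom.coe_coe, springer_gen_pi,
    coeffHom_single_self]

/-- `∂(1) = 0`. [cite: Milnor1970, §5 Cor. 5.1 «∂(u) = 0» (p0017 L16–L22)] -/
theorem sndResidue_one : sndResidue v hπ 1 = 0 := by
  rw [← gen_one, sndResidue_gen_of_addVal_eq_zero v hπ (addVal_one v)]

/-- `ψ(x) = (x̄′)` when `v(x)` is even. [cite: Milnor1970, §5 «(u) ↦ (ū)» (p0017 L7–L8)] -/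
theorem fstResidue_gen_of_even {x : Kˣ} (hx : Even (addVal v x)) :
    fstResidue v hπ (gen K x) = gen (ValResidueField v) (res v hπ x) := by
  rw [← valParity_eq_zero_iff v] at hx
  rw [fstResidue, AddMonoidHom.comp_apply, RingHom.toAddMonoidHom_eq_coe, AddMonoidHom.coe_coe, springer_gen, hx,
    coeffHom_single_self]

/-- `ψ(x) = 0` when `v(x)` is odd. [cite: Milnor1970, §5 «WE = W₀ ⊕ (π)W₀» (p0017 L5–L8)] -/
theorem fstResidue_gen_of_odd {x : Kˣ} (hx : Odd (addVal v x)) : fstResidue v hπ (gen K x) = 0 := by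
  rw [← valParity_eq_one_iff v] at hx
  rw [fstResidue, AddMonoidHom.comp_apply, RingHom.toAddMonoidHom_eq_coe, AddMonoidHom.coe_coe, springer_gen, hx,
    coeffHom_single_of_ne v zmod_two_one_ne_zero.symm]

/-- **`ψ(u) = (ū)`** for a unit `u`. [cite: Milnor1970, §5 Springer's theorem «(u) ↦ (ū)» (p0017 L7–L8)] -/
theorem fstResidue_gen_of_addVal_eq_zero {u : Kˣ} (hu : addVal v u = 0) :
    fstResidue v hπ (gen K u) = gen (ValResidueField v) (res v hπ u) :=
  fstResidue_gen_of_even v hπ (by rw [hu]; exact Even.zero)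

/-- **`ψ(πu) = 0`** for a unit `u`. [cite: Milnor1970, §5 «WE = W₀ ⊕ (π)W₀» (p0017 L5–L8)] -/
theorem fstResidue_gen_pi_mul {u : Kˣ} (hu : addVal v u = 0) : fstResidue v hπ (gen K (π * u)) = 0 :=
  fstResidue_gen_of_odd v hπ (by rw [addVal_mul, hπ, hu, add_zero]; exact odd_one)

/-- `ψ(1) = 1`. [cite: Milnor1970, §5 (p0017 L5–L8)] -/
theorem fstResidue_one : fstResidue v hπ 1 = 1 := by
  rw [← gen_one, fstResidue_gen_of_addVal_eq_zero v hπ (addVal_one v), res_of_addVal_eq_zero v hπ (addVal_one v)]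
  have h1 : unitOfEqOne v 1 (addVal_one v) = 1 := Subtype.ext rfl
  rw [h1, map_one, gen_one]

/-- **The augmentation `a + bt ↦ a + b` of `W(K̄)[ℤ/2]`** (`t ↦ 1`), a ring homomorphism. [cite: Milnor1970, §5 Lemma 5.4 «ρ(u) = (ū), ρ(πu) = (ū)» (p0018 L31–L39)] -/
def augHom : springerRing v →+* WittRing (ValResidueField v) :=
  AddMonoidAlgebra.liftNCRingHom (RingHom.id (WittRing (ValResidueField v)))
    (1 : Multiplicative (ZMod 2) →* WittRing (ValResidueField v)) fun _ _ => Commute.one_right _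

/-- `augHom (w·tⁱ) = w`. [cite: Milnor1970, §5 Lemma 5.4 (p0018 L31–L39)] -/
theorem augHom_single (i : ZMod 2) (w : WittRing (ValResidueField v)) : augHom v (AddMonoidAlgebra.single i w) = w := by
  rw [augHom, AddMonoidAlgebra.liftNCRingHom_single, RingHom.id_apply, MonoidHom.one_apply, mul_one]

/-- `augHom s = s.coeff 0 + s.coeff 1`. [cite: Milnor1970, §5 Lemma 5.4 (p0018 L31–L39)] -/
theorem augHom_eq (s : springerRing v) : augHom v s = s.coeff 0 + s.coeff 1 := by
  conv_lhs => rw [eq_single_add_single v s]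
  rw [map_add, augHom_single, augHom_single]

/-- **Lemma 5.4's `ρ : W(K) → W(K̄)`, `ρ(u) = (ū)`, `ρ(πu) = (ū)` — a RING homomorphism** (the augmentation of
`springer`; Milnor: «It follows from Springer's theorem […] that ρ is a well defined ring homomorphism»). [cite: Milnor1970, §5 Lemma 5.4 and its proof (p0018 L27–L44)] -/
def rho : WittRing K →+* WittRing (ValResidueField v) := (augHom v).comp (springer v hπ)

/-- **`ρ(x) = (x̄′)`**: the class of the residue of the unit part of `x`. [cite: Milnor1970, §5 Lemma 5.4 «ρ(u) = (ū), ρ(πu) = (ū)» (p0018 L31–L35)] -/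
theorem rho_gen (x : Kˣ) : rho v hπ (gen K x) = gen (ValResidueField v) (res v hπ x) := by
  rw [rho, RingHom.comp_apply, springer_gen, augHom_single]

/-- **`ρ(u) = (ū)`.** [cite: Milnor1970, §5 Lemma 5.4 (p0018 L33)] -/
theorem rho_gen_of_addVal_eq_zero {u : Kˣ} (hu : addVal v u = 0) :
    rho v hπ (gen K u) = gen (ValResidueField v) (residueUnitHom v (unitOfEqOne v u hu)) := by
  rw [rho_gen, res_of_addVal_eq_zero v hπ hu]

/-- **`ρ(πu) = (ū)`.** [cite: Milnor1970, §5 Lemma 5.4 (p0018 L35)] -/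
theorem rho_gen_pi_mul {u : Kˣ} (hu : addVal v u = 0) :
    rho v hπ (gen K (π * u)) = gen (ValResidueField v) (residueUnitHom v (unitOfEqOne v u hu)) := by
  rw [rho_gen, map_mul, res_pi, one_mul, res_of_addVal_eq_zero v hπ hu]

/-- `ρ(π) = 1`. [cite: Milnor1970, §5 Lemma 5.4 (p0018 L35)] -/
theorem rho_gen_pi : rho v hπ (gen K π) = 1 := by rw [rho_gen, res_pi, gen_one]

/-- **`ρ = ψ + ∂`.** [cite: Milnor1970, §5 Lemma 5.4 (p0018 L31–L35) with Cor. 5.1 (p0017 L16–L22)] -/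
theorem rho_eq_fstResidue_add_sndResidue (w : WittRing K) : rho v hπ w = fstResidue v hπ w + sndResidue v hπ w := by
  rw [rho, RingHom.comp_apply, augHom_eq, fstResidue_apply, sndResidue_apply]

/-- Every `r ∈ K̄•` is `ū` for a unit `u ∈ K•`. [cite: Milnor1970, §2 «the natural homomorphism U → F̄•» (p0005 L33–L34)] -/
theorem exists_unit_res_eq (r : (ValResidueField v)ˣ) : ∃ u : Kˣ, addVal v u = 0 ∧ res v hπ u = r := by
  obtain ⟨w, hw⟩ := residueUnitHom_surjective v r
  refine ⟨(w : Kˣ), MilnorK.addVal_coe_unitGroup v w, ?_⟩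
  rw [res_of_addVal_eq_zero v hπ (MilnorK.addVal_coe_unitGroup v w), ← hw]
  congr 1

/-- **`∂` is onto** (`∂(πu) = (ū)` and `W(K̄)` is generated by the `(ū)`). [cite: Milnor1970, §5 Cor. 5.1, exactness at the right of «0 → WĒ → WE → WĒ → 0» (p0017 L11–L22)] -/
theorem sndResidue_surjective : Function.Surjective (sndResidue v hπ) := by
  rw [← AddMonoidHom.range_eq_top, eq_top_iff, ← closure_range_gen (ValResidueField v), AddSubgroup.closure_le]
  rintro _ ⟨r, rfl⟩
  obtain ⟨u, hu, hur⟩ := exists_unit_res_eq v hπ r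
  exact ⟨gen K (π * u), by rw [sndResidue_gen_pi_mul v hπ hu, hur]⟩

/-- `ψ` is onto. [cite: Milnor1970, §5 Springer's theorem «W₀ canonically isomorphic to WĒ» (p0017 L5–L8)] -/
theorem fstResidue_surjective : Function.Surjective (fstResidue v hπ) := by
  rw [← AddMonoidHom.range_eq_top, eq_top_iff, ← closure_range_gen (ValResidueField v), AddSubgroup.closure_le]
  rintro _ ⟨r, rfl⟩
  obtain ⟨u, hu, hur⟩ := exists_unit_res_eq v hπ r
  exact ⟨gen K u, by rw [fstResidue_gen_of_addVal_eq_zero v hπ hu, hur]⟩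

/-- `ρ` is onto. [cite: Milnor1970, §5 Lemma 5.4 «L₀ is a retract of WE under a ring homomorphism ρ» (p0018 L27–L30)] -/
theorem rho_surjective : Function.Surjective (rho v hπ) := by
  rw [← RingHom.range_eq_top, eq_top_iff]
  rintro w -
  have hw : w ∈ AddSubgroup.closure (Set.range (gen (ValResidueField v))) := by rw [closure_range_gen]; trivial
  induction hw using AddSubgroup.closure_induction with
  | mem y hy =>
    obtain ⟨r, rfl⟩ := hy
    obtain ⟨u, -, hur⟩ := exists_unit_res_eq v hπ r
    exact ⟨gen K u, by rw [rho_gen, hur]⟩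
  | zero => exact zero_mem _
  | add y z _ _ hy hz => exact add_mem hy hz
  | neg y _ hy => exact neg_mem hy

/-! ### `∂(IⁿK) ⊂ Iⁿ⁻¹K̄` -/

/-- **The ideal `J = {a + bt : a + b ∈ I(K̄)}` of `W(K̄)[ℤ/2]`** (the preimage of `I(K̄)` under the augmentation; the
image of `IE = IĒ ⊕ ((π) − (1))WĒ`). [cite: Milnor1970, §5 proof of Cor. 5.2 «IE = IĒ ⊕ ((π) − (1))WĒ» (p0017 L28–L30)] -/
def augIdeal' : Ideal (springerRing v) := (fundIdeal (ValResidueField v)).comap (augHom v)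

/-- Membership in `J`. [cite: Milnor1970, §5 proof of Cor. 5.2 (p0017 L28–L30)] -/
theorem mem_augIdeal'_iff (s : springerRing v) : s ∈ augIdeal' v ↔ s.coeff 0 + s.coeff 1 ∈ fundIdeal (ValResidueField v) := by
  rw [augIdeal', Ideal.mem_comap, augHom_eq]

/-- `springer ((x) − 1) ∈ J`. [cite: Milnor1970, §5 proof of Cor. 5.2 (p0017 L28–L30)] -/
theorem springer_gen_sub_one_mem (x : Kˣ) : springer v hπ (gen K x - 1) ∈ augIdeal' v := by
  rw [augIdeal', Ideal.mem_comap, map_sub, map_one, map_sub, map_one]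
  have h : augHom v (springer v hπ (gen K x)) = rho v hπ (gen K x) := rfl
  rw [h, rho_gen]
  exact gen_sub_one_mem _ _

/-- `springer (I(K)) ⊂ J`. [cite: Milnor1970, §5 proof of Cor. 5.2 «IE = IĒ ⊕ ((π) − (1))WĒ» (p0017 L28–L30)] -/
theorem fundIdeal_map_springer_le : (fundIdeal K).map (springer v hπ) ≤ augIdeal' v := by
  rw [fundIdeal, Ideal.map_span, Ideal.span_le]
  rintro _ ⟨_, ⟨a, rfl⟩, rfl⟩
  exact springer_gen_sub_one_mem v hπ a

/-- `springer (IⁿK) ⊂ Jⁿ`. [cite: Milnor1970, §5 proof of Cor. 5.2 «IⁿE = IⁿĒ ⊕ ((π) − (1)) Iⁿ⁻¹Ē» (p0017 L32–L33)] -/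
theorem springer_mem_pow {n : ℕ} {w : WittRing K} (hw : w ∈ fundIdeal K ^ n) : springer v hπ w ∈ augIdeal' v ^ n := by
  have h := Ideal.mem_map_of_mem (springer v hπ) hw
  rw [Ideal.map_pow] at h
  exact Ideal.pow_right_mono (fundIdeal_map_springer_le v hπ) n h

/-- The augmentation of `Jⁿ` lies in `Iⁿ(K̄)`. [cite: Milnor1970, §5 proof of Cor. 5.2 (p0017 L32–L33)] -/
theorem augHom_mem_pow_of_mem_pow {n : ℕ} {s : springerRing v} (hs : s ∈ augIdeal' v ^ n) :
    augHom v s ∈ fundIdeal (ValResidueField v) ^ n := by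
  have h := Ideal.le_comap_pow (augHom v) (K := fundIdeal (ValResidueField v)) n hs
  rwa [Ideal.mem_comap] at h

/-- The `t`-coefficient of a product in `W(K̄)[ℤ/2]`: `(a + bt)(c + dt) = (ac + bd) + (ad + bc)t`. [cite: Milnor1970, §5 «(π)² = (1)» (p0017 L9–L10)] -/
theorem coeff_one_mul (s s' : springerRing v) :
    (s * s').coeff 1 = s.coeff 0 * s'.coeff 1 + s.coeff 1 * s'.coeff 0 := by
  conv_lhs => rw [eq_single_add_single v s, eq_single_add_single v s']
  rw [← coeffHom_apply, add_mul, mul_add, mul_add]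
  simp only [AddMonoidAlgebra.single_mul_single, map_add, add_zero, zero_add, zmod_two_add_self,
    coeffHom_single_self, coeffHom_single_of_ne v zmod_two_one_ne_zero]

/-- **The `t`-coefficient of `Jⁿ⁺¹` lies in `Iⁿ(K̄)`** (induction on `n`: for `a + bt ∈ Jⁿ⁺¹`, `c + dt ∈ J` the new
`t`-coefficient is `ad + bc = (a + b)d + b(c + d) − 2bd ∈ Iⁿ⁺¹`, as `2 ∈ I`; the powers of the ideal `J` of the
group ring are used only through `Jⁿ⁺² = Jⁿ⁺¹·J`). [cite: Milnor1970, §5 proof of Cor. 5.2 «IⁿE = IⁿĒ ⊕ ((π) − (1)) Iⁿ⁻¹Ē» (p0017 L32–L33)] -/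
theorem coeff_one_mem_pow (n : ℕ) : ∀ {s : springerRing v}, s ∈ augIdeal' v ^ (n + 1) →
    s.coeff 1 ∈ fundIdeal (ValResidueField v) ^ n := by
  induction n with
  | zero => intro s _; rw [pow_zero, Ideal.one_eq_top]; trivial
  | succ n ih =>
    intro s hs
    have hs' : s ∈ augIdeal' v ^ (n + 1) * augIdeal' v := hs
    refine Submodule.mul_induction_on hs' (fun a ha b hb => ?_) (fun x y hx hy => ?_)
    · rw [coeff_one_mul]
      have ha1 : a.coeff 1 ∈ fundIdeal (ValResidueField v) ^ n := ih ha
      have ha01 : a.coeff 0 + a.coeff 1 ∈ fundIdeal (ValResidueField v) ^ (n + 1) := by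
        rw [← augHom_eq]; exact augHom_mem_pow_of_mem_pow v ha
      have hb01 : b.coeff 0 + b.coeff 1 ∈ fundIdeal (ValResidueField v) := (mem_augIdeal'_iff v b).1 hb
      have h2 : a.coeff 1 * (2 * b.coeff 1) ∈ fundIdeal (ValResidueField v) ^ n * fundIdeal (ValResidueField v) :=
        Ideal.mul_mem_mul ha1 (Ideal.mul_mem_right _ _ (two_mem_fundIdeal _))
      have h3 : a.coeff 1 * (b.coeff 0 + b.coeff 1) ∈ fundIdeal (ValResidueField v) ^ n * fundIdeal (ValResidueField v) :=
        Ideal.mul_mem_mul ha1 hb01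
      have heq : a.coeff 0 * b.coeff 1 + a.coeff 1 * b.coeff 0 =
          (a.coeff 0 + a.coeff 1) * b.coeff 1 + a.coeff 1 * (b.coeff 0 + b.coeff 1) - a.coeff 1 * (2 * b.coeff 1) := by
        ring
      rw [heq]
      exact sub_mem (add_mem (Ideal.mul_mem_right _ _ ha01) h3) h2
    · rw [AddMonoidAlgebra.coeff_add, Finsupp.add_apply]
      exact add_mem hx hy

/-- **`∂(Iⁿ⁺¹K) ⊂ Iⁿ(K̄)`** — the map of Milnor's split exact sequence (7ₙ₊₁) `0 → Iⁿ⁺¹Ē → Iⁿ⁺¹E →∂ IⁿĒ → 0`, here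
for the presented Witt ring of any discretely valued field. [cite: Milnor1970, §5 proof of Cor. 5.2, (7ₙ) (p0017 L28–L38); Theorem 5.3 footing «∂_π» (p0018 L9–L13)] -/
theorem sndResidue_mem_pow {n : ℕ} {w : WittRing K} (hw : w ∈ fundIdeal K ^ (n + 1)) :
    sndResidue v hπ w ∈ fundIdeal (ValResidueField v) ^ n := by
  rw [sndResidue_apply]
  exact coeff_one_mem_pow v n (springer_mem_pow v hπ hw)

/-- `ρ(IⁿK) ⊂ Iⁿ(K̄)` (`ρ` is a ring homomorphism with `ρ((x) − 1) = (x̄′) − 1`). [cite: Milnor1970, §5 Lemma 5.4 (p0018 L27–L39)] -/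
theorem rho_mem_pow {n : ℕ} {w : WittRing K} (hw : w ∈ fundIdeal K ^ n) : rho v hπ w ∈ fundIdeal (ValResidueField v) ^ n := by
  rw [rho, RingHom.comp_apply]
  exact augHom_mem_pow_of_mem_pow v (springer_mem_pow v hπ hw)

/-- `ψ(Iⁿ⁺¹K) ⊂ Iⁿ(K̄)` (`ψ = ρ − ∂`). [cite: Milnor1970, §5 proof of Cor. 5.2 (p0017 L28–L38)] -/
theorem fstResidue_mem_pow {n : ℕ} {w : WittRing K} (hw : w ∈ fundIdeal K ^ (n + 1)) :
    fstResidue v hπ w ∈ fundIdeal (ValResidueField v) ^ n := by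
  have h : fstResidue v hπ w = rho v hπ w - sndResidue v hπ w := by rw [rho_eq_fstResidue_add_sndResidue, add_sub_cancel_right]
  rw [h]
  exact sub_mem (Ideal.pow_le_pow_right (Nat.le_succ n) (rho_mem_pow v hπ hw)) (sndResidue_mem_pow v hπ hw)

end Residue

end WittRing

end Literature.RingTheory.KTheory

end
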